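import Summits.QuantumFields.YangMills.Theorems.AllWindowsColdBoxBoxHighLineFPOperatorFloor

/-!
# T-S5.4i «Dirichlet Green Hilbert–Schmidt bound» — the ℓ² row sums and the trace `tr(G Gᵀ)` of the interior Dirichlet
# Green's function `G = (boxLap (2H) univ)⁻¹`

Untabled brick of step (1b) (planner ym-idea-2 g17, `STUB-PLAN-S5U5-STEP1b.md` §3) for the XL comparison stubs S5 (LINE-19
⟨stmt-QuantumFields-24004⟩/⟨24335⟩) and U5 (LINE-20 ⟨24336⟩): the budget number `E_G Σ_x |A_x|² = (2β)⁻¹ tr (MᵀM)⁻¹` of the Laplace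
asymptotics T-S5.4 (see ✓T-S5.4h `gaussianSecondMoment`: `E_G[‖B A‖²] = (2β)⁻¹ ‖B M⁻¹‖_F²`) needs, at `M = fpOperator H 1 = boxLap ⊗ 1₃`,
the Hilbert–Schmidt norm of the Dirichlet Green's function.  Companion of w5 g21's ✓T-S5.4f-i `dirichletGreenRowSum` (the ROW-ℓ¹ sum
`Σ_t |G s t| ≤ C H²`); here the ℓ² row sum, which is only POLYLOGARITHMIC:

* **`dirichletGreenRowSqSum`**: `Σ_t (G s t)² ≤ C · (1 + log H)⁴` for every interior site `s` (`H ≥ 1`);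
* **`dirichletGreenHilbertSchmidt`**: `Σ_s Σ_t (G s t)² ≤ C · H⁴ · (1 + log H)⁴`, i.e. `‖G‖_HS² = tr(G Gᵀ) = O(H⁴ log⁴ H)`.

Route: square the geometric-mean bound of ✓`boxLap_inv_size_decay` used in 4f-i (`|G s t| ≤ C₀ ∏_κ (1+|s_κ−t_κ|)^{-1/2}`, w5's
`le_mul_prod_of_forall_le_mul_pow_four`) to get `(G s t)² ≤ C₀² ∏_κ (1+|s_κ−t_κ|)⁻¹`; the sum over the box is bounded by the sum over
`(Fin 2H)⁴`, which factorises (`Fintype.prod_sum`) into four harmonic-type sums `Σ_m (1+|a−m|)⁻¹ ≤ 2(1 + log 2H)` (`sum_inv_dist_le`, from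
Mathlib's `harmonic_le_one_add_log`).  The sharp order is a single `log H` (ℓ∞-shell count `#{‖Δ‖∞ = d} ≍ d³` against `(1+d)⁻⁴`); the
factorised `log⁴` costs nothing in the power counting of STEP1b §3–§4 (polylogs against powers of `β`), so the cheap form is filed.

Tree (✓…FPOperatorFloor, ✓…BoxKernelSizeDecay) + Mathlib; no definitions.  HONEST LABEL: an elementary brick of step (1b); T-S5.4 proper,
S5, U5, ⟨24004⟩ ⟨24335⟩ ⟨24336⟩ remain OPEN; no summit is proved; the Yang–Mills mass gap is NOT proved by this file.
Seat ym-line-sfw-p2 g77 (LEAD, cell ym-idea-1).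
-/

set_option autoImplicit false

noncomputable section

open Matrix Finset
open Summit.QuantumFields.YangMills.Theorems.AllWindowsColdBox.BoxKernel (Box boxLap boxLap_inv_size_decay)

namespace Summit.QuantumFields.YangMills.Theorems.AllWindowsColdBoxBoxHighLine

namespace DirichletGreenHilbertSchmidt

open FPOperatorFloor

/-! ## One-dimensional harmonic-type sums -/

/-- `Σ_{j<n} 1/(1+j) ≤ 1 + log n` (Mathlib's `harmonic_le_one_add_log`, read through the casts; for `n = 0` both sides are fine). -/
theorem sum_inv_one_add_le (n : ℕ) : ∑ j ∈ Finset.range n, 1 / (1 + (j : ℝ)) ≤ 1 + Real.log n := by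
  have h := harmonic_le_one_add_log n
  have hc : ((harmonic n : ℚ) : ℝ) = ∑ j ∈ Finset.range n, 1 / (1 + (j : ℝ)) := by
    simp only [harmonic, Rat.cast_sum, Rat.cast_inv, Nat.cast_add, Nat.cast_one, one_div]
    refine Finset.sum_congr rfl fun j _ => ?_
    push_cast
    ring
  linarith [hc ▸ h]

/-- The shifted sum `Σ_{j<n} 1/(2+j) ≤ 1 + log n`. -/
theorem sum_inv_two_add_le (n : ℕ) : ∑ j ∈ Finset.range n, 1 / (1 + ((j + 1 : ℕ) : ℝ)) ≤ 1 + Real.log n := by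
  refine (Finset.sum_le_sum fun j _ => ?_).trans (sum_inv_one_add_le n)
  push_cast
  exact one_div_le_one_div_of_le (by positivity) (by linarith)

/-- `Σ_{m<N} 1/(1 + |a − m|) ≤ 2(1 + log N)` for `a < N` (split at `m = a` into two one-sided harmonic sums). -/
theorem sum_inv_dist_le {N a : ℕ} (ha : a < N) :
    ∑ m ∈ Finset.range N, 1 / (1 + |(a : ℝ) - m|) ≤ 2 * (1 + Real.log N) := by
  have hN : (0 : ℝ) < N := by exact_mod_cast (Nat.zero_le a).trans_lt ha
  have hlog : ∀ k : ℕ, k ≤ N → 1 + Real.log k ≤ 1 + Real.log N := by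
    intro k hk
    rcases Nat.eq_zero_or_pos k with rfl | hk0
    · simp only [Nat.cast_zero, Real.log_zero, add_zero]
      linarith [Real.log_nonneg (show (1 : ℝ) ≤ N by exact_mod_cast (Nat.succ_le_of_lt ((Nat.zero_le a).trans_lt ha)))]
    · have := Real.log_le_log (by exact_mod_cast hk0) (show (k : ℝ) ≤ N by exact_mod_cast hk)
      linarith
  rw [← Finset.sum_range_add_sum_Ico _ ha.le]
  have h1 : ∑ m ∈ Finset.range a, 1 / (1 + |(a : ℝ) - m|) ≤ 1 + Real.log N := by
    have hre : ∑ m ∈ Finset.range a, 1 / (1 + |(a : ℝ) - m|) =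
        ∑ j ∈ Finset.range a, 1 / (1 + ((j + 1 : ℕ) : ℝ)) := by
      rw [← Finset.sum_range_reflect (fun m => 1 / (1 + |(a : ℝ) - m|)) a]
      refine Finset.sum_congr rfl fun j hj => ?_
      have hj' := Finset.mem_range.1 hj
      rw [abs_natCast_sub_of_le (by omega)]
      congr 3
      omega
    rw [hre]
    exact (sum_inv_two_add_le a).trans (hlog a ha.le)
  have h2 : ∑ m ∈ Finset.Ico a N, 1 / (1 + |(a : ℝ) - m|) ≤ 1 + Real.log N := by
    rw [Finset.sum_Ico_eq_sum_range]
    have hre : ∑ k ∈ Finset.range (N - a), 1 / (1 + |(a : ℝ) - ((a + k : ℕ) : ℝ)|) =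
        ∑ k ∈ Finset.range (N - a), 1 / (1 + (k : ℝ)) := by
      refine Finset.sum_congr rfl fun k _ => ?_
      rw [abs_natCast_sub_of_ge (by omega), Nat.add_sub_cancel_left]
    rw [hre]
    exact (sum_inv_one_add_le (N - a)).trans (hlog (N - a) (by omega))
  linarith

/-- `2(1 + log(2H)) ≤ 4(1 + log H)` for `H ≥ 1` (`log 2 < 1`). -/
theorem two_mul_one_add_log_two_mul_le {H : ℕ} (hH : 1 ≤ H) :
    2 * (1 + Real.log ((2 * H : ℕ) : ℝ)) ≤ 4 * (1 + Real.log H) := by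
  have hH0 : (0 : ℝ) < H := by exact_mod_cast hH
  have hlog2 : Real.log 2 < 1 := by
    have := Real.log_two_lt_d9; linarith
  have hlogH : 0 ≤ Real.log H := Real.log_nonneg (by exact_mod_cast hH)
  push_cast
  rw [Real.log_mul two_ne_zero hH0.ne']
  linarith

end DirichletGreenHilbertSchmidt

open FPOperatorFloor DirichletGreenHilbertSchmidt

/-! ## T-S5.4i -/

/-- **T-S5.4i (ℓ² row sums of the interior Dirichlet Green's function are `O(log⁴ H)`)**: with `G = (boxLap (2H) univ)⁻¹`,
`Σ_t (G s t)² ≤ C (1 + log H)⁴` for every interior site `s` (constant `256·C₀²`, `C₀` the constant of ✓`boxLap_inv_size_decay`). -/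
theorem dirichletGreenRowSqSum : ∃ C : ℝ, 0 ≤ C ∧ ∀ H : ℕ, 1 ≤ H → ∀ s : Box 4 (2 * H) Finset.univ,
    ∑ t, ((boxLap (2 * H) (Finset.univ : Finset (Fin 4)))⁻¹ s t) ^ 2 ≤ C * (1 + Real.log H) ^ 4 := by
  classical
  obtain ⟨C₀, hC₀, hdec⟩ := boxLap_inv_size_decay
  refine ⟨256 * C₀ ^ 2, by positivity, fun H hH s => ?_⟩
  haveI : NeZero (2 * H) := ⟨by omega⟩
  -- the coordinate weights `(1 + |s_κ − m|)^{-1/2}` of 4f-i and their squares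
  set w : Fin 4 → Fin (2 * H) → ℝ := fun κ m => 1 / Real.sqrt (1 + |((s.1 κ : ℕ) : ℝ) - ((m : ℕ) : ℝ)|) with hw
  set w' : Fin 4 → Fin (2 * H) → ℝ := fun κ m => 1 / (1 + |((s.1 κ : ℕ) : ℝ) - ((m : ℕ) : ℝ)|) with hw'
  have hw_pos : ∀ κ m, 0 < w κ m := fun κ m => by simp only [hw]; positivity
  have hw'_pos : ∀ κ m, 0 < w' κ m := fun κ m => by simp only [hw']; positivity
  have hww : ∀ κ m, (w κ m) ^ 2 = w' κ m := fun κ m => by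
    simp only [hw, hw']
    rw [_root_.one_div_pow, Real.sq_sqrt (by positivity)]
  have hsq4 : ∀ x : ℝ, 0 ≤ x → (1 / Real.sqrt x) ^ 4 = 1 / x ^ 2 := fun x hx => by
    rw [_root_.one_div_pow, show Real.sqrt x ^ 4 = (Real.sqrt x ^ 2) ^ 2 by ring, Real.sq_sqrt hx]
  have hw4 : ∀ κ m, (w κ m) ^ 4 = 1 / (1 + |((s.1 κ : ℕ) : ℝ) - ((m : ℕ) : ℝ)|) ^ 2 := by
    intro κ m
    simp only [hw]
    exact hsq4 _ (by positivity)
  -- pointwise: `|G s t| ≤ C₀ ∏_κ w κ (t κ)`, hence `(G s t)² ≤ C₀² ∏_κ w' κ (t κ)`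
  have hpt : ∀ t : Box 4 (2 * H) Finset.univ,
      |(boxLap (2 * H) (Finset.univ : Finset (Fin 4)))⁻¹ s t| ≤ C₀ * ∏ κ, w κ (t.1 κ) := by
    intro t
    refine le_mul_prod_of_forall_le_mul_pow_four (abs_nonneg _) hC₀ (fun κ => (hw_pos κ (t.1 κ)).le) fun κ => ?_
    rw [hw4, mul_one_div, le_div_iff₀ (by positivity)]
    exact hdec (2 * H) Finset.univ Finset.univ_nonempty κ s t
  have hpt2 : ∀ t : Box 4 (2 * H) Finset.univ,
      ((boxLap (2 * H) (Finset.univ : Finset (Fin 4)))⁻¹ s t) ^ 2 ≤ C₀ ^ 2 * ∏ κ, w' κ (t.1 κ) := by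
    intro t
    have h := hpt t
    have h0 : 0 ≤ C₀ * ∏ κ, w κ (t.1 κ) := mul_nonneg hC₀ (Finset.prod_nonneg fun κ _ => (hw_pos κ (t.1 κ)).le)
    calc ((boxLap (2 * H) (Finset.univ : Finset (Fin 4)))⁻¹ s t) ^ 2
        = |(boxLap (2 * H) (Finset.univ : Finset (Fin 4)))⁻¹ s t| ^ 2 := (sq_abs _).symm
      _ ≤ (C₀ * ∏ κ, w κ (t.1 κ)) ^ 2 := pow_le_pow_left₀ (abs_nonneg _) h 2
      _ = C₀ ^ 2 * ∏ κ, w' κ (t.1 κ) := by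
          rw [mul_pow, ← Finset.prod_pow]
          simp_rw [hww]
  -- one-dimensional sums
  have h1d : ∀ κ, ∑ m : Fin (2 * H), w' κ m ≤ 4 * (1 + Real.log H) := by
    intro κ
    rw [Fin.sum_univ_eq_sum_range (fun m => 1 / (1 + |((s.1 κ : ℕ) : ℝ) - ((m : ℕ) : ℝ)|)) (2 * H)]
    exact (sum_inv_dist_le (s.1 κ).isLt).trans (two_mul_one_add_log_two_mul_le hH)
  -- sum over the box ≤ sum over the whole grid, which factorises
  have hsub : ∑ t : Box 4 (2 * H) Finset.univ, C₀ ^ 2 * ∏ κ, w' κ (t.1 κ) ≤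
      ∑ t : Fin 4 → Fin (2 * H), C₀ ^ 2 * ∏ κ, w' κ (t κ) := by
    rw [← Finset.sum_subtype (Finset.univ.filter fun t : Fin 4 → Fin (2 * H) => ∀ ν ∈ (Finset.univ : Finset (Fin 4)), (t ν : ℕ) ≠ 0)
      (by simp) (fun t : Fin 4 → Fin (2 * H) => C₀ ^ 2 * ∏ κ, w' κ (t κ))]
    exact Finset.sum_le_univ_sum_of_nonneg fun t => mul_nonneg (sq_nonneg _) (Finset.prod_nonneg fun κ _ => (hw'_pos κ (t κ)).le)
  have hlog0 : 0 ≤ 1 + Real.log H := by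
    have := Real.log_nonneg (show (1 : ℝ) ≤ H by exact_mod_cast hH); linarith
  calc ∑ t, ((boxLap (2 * H) (Finset.univ : Finset (Fin 4)))⁻¹ s t) ^ 2
      ≤ ∑ t : Box 4 (2 * H) Finset.univ, C₀ ^ 2 * ∏ κ, w' κ (t.1 κ) := Finset.sum_le_sum fun t _ => hpt2 t
    _ ≤ ∑ t : Fin 4 → Fin (2 * H), C₀ ^ 2 * ∏ κ, w' κ (t κ) := hsub
    _ = C₀ ^ 2 * ∏ κ : Fin 4, ∑ m : Fin (2 * H), w' κ m := by rw [← Finset.mul_sum, Fintype.prod_sum]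
    _ ≤ C₀ ^ 2 * ∏ _κ : Fin 4, (4 * (1 + Real.log H)) := by
        refine mul_le_mul_of_nonneg_left (Finset.prod_le_prod (fun κ _ => Finset.sum_nonneg fun m _ => (hw'_pos κ m).le)
          fun κ _ => h1d κ) (sq_nonneg _)
    _ = 256 * C₀ ^ 2 * (1 + Real.log H) ^ 4 := by
        rw [Finset.prod_const, Finset.card_univ, Fintype.card_fin, mul_pow]; ring

/-- **Hilbert–Schmidt norm of the interior Dirichlet Green's function**: `Σ_s Σ_t (G s t)² ≤ C · H⁴ · (1 + log H)⁴` (`H ≥ 1`), i.e.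
`tr(G Gᵀ) = ‖G‖_HS² = O(H⁴ log⁴ H)` — the `H⁴·(polylog)` of STEP1b §3 (`E_G Σ_x|A_x|² = (2β)⁻¹ tr (MᵀM)⁻¹` at `M = boxLap ⊗ 1₃`). -/
theorem dirichletGreenHilbertSchmidt : ∃ C : ℝ, 0 ≤ C ∧ ∀ H : ℕ, 1 ≤ H →
    ∑ s : Box 4 (2 * H) Finset.univ, ∑ t, ((boxLap (2 * H) (Finset.univ : Finset (Fin 4)))⁻¹ s t) ^ 2 ≤
      C * (H : ℝ) ^ 4 * (1 + Real.log H) ^ 4 := by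
  classical
  obtain ⟨C, hC, hrow⟩ := dirichletGreenRowSqSum
  refine ⟨16 * C, by positivity, fun H hH => ?_⟩
  haveI : NeZero (2 * H) := ⟨by omega⟩
  have hcard : (Fintype.card (Box 4 (2 * H) (Finset.univ : Finset (Fin 4))) : ℝ) ≤ 16 * (H : ℝ) ^ 4 := by
    have h1 : Fintype.card (Box 4 (2 * H) (Finset.univ : Finset (Fin 4))) ≤ Fintype.card (Fin 4 → Fin (2 * H)) :=
      Fintype.card_subtype_le _
    rw [Fintype.card_fun, Fintype.card_fin, Fintype.card_fin] at h1
    calc (Fintype.card (Box 4 (2 * H) (Finset.univ : Finset (Fin 4))) : ℝ) ≤ (((2 * H) ^ 4 : ℕ) : ℝ) := by exact_mod_cast h1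
      _ = 16 * (H : ℝ) ^ 4 := by push_cast; ring
  have hlog0 : 0 ≤ 1 + Real.log H := by
    have := Real.log_nonneg (show (1 : ℝ) ≤ H by exact_mod_cast hH); linarith
  calc ∑ s : Box 4 (2 * H) Finset.univ, ∑ t, ((boxLap (2 * H) (Finset.univ : Finset (Fin 4)))⁻¹ s t) ^ 2
      ≤ ∑ _s : Box 4 (2 * H) Finset.univ, C * (1 + Real.log H) ^ 4 := Finset.sum_le_sum fun s _ => hrow H hH s
    _ = (Fintype.card (Box 4 (2 * H) (Finset.univ : Finset (Fin 4))) : ℝ) * (C * (1 + Real.log H) ^ 4) := by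
        rw [Finset.sum_const, Finset.card_univ, nsmul_eq_mul]
    _ ≤ 16 * (H : ℝ) ^ 4 * (C * (1 + Real.log H) ^ 4) :=
        mul_le_mul_of_nonneg_right hcard (mul_nonneg hC (pow_nonneg hlog0 4))
    _ = 16 * C * (H : ℝ) ^ 4 * (1 + Real.log H) ^ 4 := by ring

/-- The same number as a TRACE: `tr(G Gᵀ) = Σ_s Σ_t (G s t)²` for `G = (boxLap (2H) univ)⁻¹`, hence `≤ C H⁴ (1 + log H)⁴`. -/
theorem trace_dirichletGreen_mul_transpose_le : ∃ C : ℝ, 0 ≤ C ∧ ∀ H : ℕ, 1 ≤ H →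
    ((boxLap (2 * H) (Finset.univ : Finset (Fin 4)))⁻¹ * ((boxLap (2 * H) (Finset.univ : Finset (Fin 4)))⁻¹)ᵀ).trace ≤
      C * (H : ℝ) ^ 4 * (1 + Real.log H) ^ 4 := by
  obtain ⟨C, hC, h⟩ := dirichletGreenHilbertSchmidt
  refine ⟨C, hC, fun H hH => ?_⟩
  have htr : ((boxLap (2 * H) (Finset.univ : Finset (Fin 4)))⁻¹ * ((boxLap (2 * H) (Finset.univ : Finset (Fin 4)))⁻¹)ᵀ).trace =
      ∑ s : Box 4 (2 * H) Finset.univ, ∑ t, ((boxLap (2 * H) (Finset.univ : Finset (Fin 4)))⁻¹ s t) ^ 2 := by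
    simp only [Matrix.trace, Matrix.diag, Matrix.mul_apply, Matrix.transpose_apply, pow_two]
  rw [htr]
  exact h H hH

end Summit.QuantumFields.YangMills.Theorems.AllWindowsColdBoxBoxHighLine

end
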